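import Summits.RiemannHypothesis.RiemannHypothesis.Theorems.WeilTwoPrimeDeflE25ODef
import Summits.RiemannHypothesis.RiemannHypothesis.Theorems.WeilTwoPrimeDeflE25ODataPO29
import Literature.NumberTheory.LFunctions.WeilBlockRowsR
import HarnessLib

/-!
# Deflated two-prime certificate E25O: the materialized odd block agrees with `P_r + Σ μ ĉ ĉᵀ`, rows 80–89

`WeilCert.checkPmRowG` for certificate E25O (odd block), by `decide +kernel`. Pure proof file; nothing is asserted.
-/

set_option linter.dupNamespace false

noncomputable section

namespace Summit.RiemannHypothesis.RiemannHypothesis.Theorems.EvenWinsBeyondArch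

open Literature.NumberTheory.LFunctions

set_option maxHeartbeats 0 in
/-- Row 80 of the materialized odd block is row 80 of `P_r + Σ μ ĉ ĉᵀ` (certificate E25O). [folklore] -/
theorem checkPmRowG1_80_weilCertDeflE25O : weilCertDeflE25OBase.checkPmRowG weilCertDeflE25OP weilCertDeflE25OPmO 1 80 = true := by
  decide +kernel

set_option maxHeartbeats 0 in
/-- Row 81 of the materialized odd block is row 81 of `P_r + Σ μ ĉ ĉᵀ` (certificate E25O). [folklore] -/
theorem checkPmRowG1_81_weilCertDeflE25O : weilCertDeflE25OBase.checkPmRowG weilCertDeflE25OP weilCertDeflE25OPmO 1 81 = true := by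
  decide +kernel

set_option maxHeartbeats 0 in
/-- Row 82 of the materialized odd block is row 82 of `P_r + Σ μ ĉ ĉᵀ` (certificate E25O). [folklore] -/
theorem checkPmRowG1_82_weilCertDeflE25O : weilCertDeflE25OBase.checkPmRowG weilCertDeflE25OP weilCertDeflE25OPmO 1 82 = true := by
  decide +kernel

set_option maxHeartbeats 0 in
/-- Row 83 of the materialized odd block is row 83 of `P_r + Σ μ ĉ ĉᵀ` (certificate E25O). [folklore] -/
theorem checkPmRowG1_83_weilCertDeflE25O : weilCertDeflE25OBase.checkPmRowG weilCertDeflE25OP weilCertDeflE25OPmO 1 83 = true := by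
  decide +kernel

set_option maxHeartbeats 0 in
/-- Row 84 of the materialized odd block is row 84 of `P_r + Σ μ ĉ ĉᵀ` (certificate E25O). [folklore] -/
theorem checkPmRowG1_84_weilCertDeflE25O : weilCertDeflE25OBase.checkPmRowG weilCertDeflE25OP weilCertDeflE25OPmO 1 84 = true := by
  decide +kernel

set_option maxHeartbeats 0 in
/-- Row 85 of the materialized odd block is row 85 of `P_r + Σ μ ĉ ĉᵀ` (certificate E25O). [folklore] -/
theorem checkPmRowG1_85_weilCertDeflE25O : weilCertDeflE25OBase.checkPmRowG weilCertDeflE25OP weilCertDeflE25OPmO 1 85 = true := by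
  decide +kernel

set_option maxHeartbeats 0 in
/-- Row 86 of the materialized odd block is row 86 of `P_r + Σ μ ĉ ĉᵀ` (certificate E25O). [folklore] -/
theorem checkPmRowG1_86_weilCertDeflE25O : weilCertDeflE25OBase.checkPmRowG weilCertDeflE25OP weilCertDeflE25OPmO 1 86 = true := by
  decide +kernel

set_option maxHeartbeats 0 in
/-- Row 87 of the materialized odd block is row 87 of `P_r + Σ μ ĉ ĉᵀ` (certificate E25O). [folklore] -/
theorem checkPmRowG1_87_weilCertDeflE25O : weilCertDeflE25OBase.checkPmRowG weilCertDeflE25OP weilCertDeflE25OPmO 1 87 = true := by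
  decide +kernel

set_option maxHeartbeats 0 in
/-- Row 88 of the materialized odd block is row 88 of `P_r + Σ μ ĉ ĉᵀ` (certificate E25O). [folklore] -/
theorem checkPmRowG1_88_weilCertDeflE25O : weilCertDeflE25OBase.checkPmRowG weilCertDeflE25OP weilCertDeflE25OPmO 1 88 = true := by
  decide +kernel

set_option maxHeartbeats 0 in
/-- Row 89 of the materialized odd block is row 89 of `P_r + Σ μ ĉ ĉᵀ` (certificate E25O). [folklore] -/
theorem checkPmRowG1_89_weilCertDeflE25O : weilCertDeflE25OBase.checkPmRowG weilCertDeflE25OP weilCertDeflE25OPmO 1 89 = true := by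
  decide +kernel


end Summit.RiemannHypothesis.RiemannHypothesis.Theorems.EvenWinsBeyondArch
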